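import Literature.MathematicalPhysics.QuantumLattice.GrassmannConjugationEffectiveAction
import Literature.MathematicalPhysics.QuantumLattice.HubbardEffectiveActionCT
import Literature.MathematicalPhysics.QuantumLattice.SymmetricRegimeFunctionals
import HarnessLib

/-!
# Time reversal `k₀ ↦ −k₀`, `c ↦ c̄` is an (antilinear) symmetry of the countertermed Hubbard effective action;
# the self-energy satisfies `Σ(−ω, k⃗) = conj Σ(ω, k⃗)`

Topic `MathematicalPhysics/QuantumLattice`; companion of `HubbardEffectiveActionCTSymmetry.lean` (`D₄`),
`HubbardEffectiveActionCTSpinFlip.lean` (spin exchange) and `GrassmannConjugationEffectiveAction.lean` (the coefficient conjugation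
`grassmannConj` passes through `effAction`).  Benfatto–Giuliani–Mastropietro 2006 §2.1 list the symmetries of `P(dψ)` and `V`; the
combination used in §2.3 to get `Σ(−k₀) = Σ(k₀)*`-type constraints is the ANTILINEAR one: complex conjugation of the coefficients
(symmetry (5)) together with the reflection of the Matsubara frequency `ω ↦ −ω` (on the tree's frequency grid `MatsubaraIdx M = Fin 2M`,
`i ↦ i.rev`, `ω_{rev i} = −ω_i`), here the permutation of the field labels `((ω, k⃗), σ, c) ↦ ((rev ω, k⃗), σ, c)` written out
(no definition, no notation) as `(Equiv.prodCongr (Equiv.prodCongr (Equiv.prodCongr Fin.revPerm (Equiv.refl (TorusSite 2 L))) (Equiv.refl (Fin 2))) (Equiv.refl (Fin 2))) = Equiv.prodCongr (Equiv.prodCongr (Equiv.prodCongr Fin.revPerm (Equiv.refl _)) (Equiv.refl _)) (Equiv.refl _)`.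

## Main statements (all proved; no definitions)

* `nambuDenCT_revFreq`, `nambuPropagatorCT_revFreq` — `G_K(−ω, k⃗)_{ab} = conj G_K(ω, k⃗)_{ab}` (any seed `h`: `φ_d`, `e_K`, `h` real);
* `toNambu_timeRev`, **`hubbardTwoPointCT_timeRev`**, `hubbardCovarianceCT_timeRev`, **`hubbardCovAboveCT_timeRev`** —
  `C^K_{>Λ}((Equiv.prodCongr (Equiv.prodCongr (Equiv.prodCongr Fin.revPerm (Equiv.refl (TorusSite 2 L))) (Equiv.refl (Fin 2))) (Equiv.refl (Fin 2)))X, (Equiv.prodCongr (Equiv.prodCongr (Equiv.prodCongr Fin.revPerm (Equiv.refl (TorusSite 2 L))) (Equiv.refl (Fin 2))) (Equiv.refl (Fin 2)))Y) = conj C^K_{>Λ}(X, Y)`;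
* `grassmannConj_psiPlus/psiMinus`, `grassmannConj_hubbardInteraction`, `grassmannConj_counterQuadratic`, `map_timeRev_hubbardInteraction`,
  `map_timeRev_counterQuadratic`, **`map_timeRev_grassmannConj_hubbardInteractionCT`** — `V_K` has real coefficients and is invariant
  under the frequency reflection (conservation `n₁ + n₃ = n₂ + n₄` of the integer labels is, since `n_{rev i} = −n_i − 1`);
* **`map_timeRev_grassmannConj_hubbardEffectiveActionCT`** — `(conj 𝒢^K_Λ) ∘ (Equiv.prodCongr (Equiv.prodCongr (Equiv.prodCongr Fin.revPerm (Equiv.refl (TorusSite 2 L))) (Equiv.refl (Fin 2))) (Equiv.refl (Fin 2)))⁻¹ = 𝒢^K_Λ`;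
  **`kernel_hubbardEffectiveActionCT_timeRev`** — `F_m((Equiv.prodCongr (Equiv.prodCongr (Equiv.prodCongr Fin.revPerm (Equiv.refl (TorusSite 2 L))) (Equiv.refl (Fin 2))) (Equiv.refl (Fin 2)))X_0, …, (Equiv.prodCongr (Equiv.prodCongr (Equiv.prodCongr Fin.revPerm (Equiv.refl (TorusSite 2 L))) (Equiv.refl (Fin 2))) (Equiv.refl (Fin 2)))X_{m−1}) = conj F_m(X_0, …, X_{m−1})`;
* `selfEnergy_timeRev`, **`selfEnergy_hubbardEffectiveActionCT_revFreq`** — `Σ((rev ω, k⃗), σ) = conj Σ((ω, k⃗), σ)`.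

## Sources

G. Benfatto, A. Giuliani, V. Mastropietro, Ann. Henri Poincaré 7 (2006) 809, §2.1 symmetries (4)–(5), §2.3
[`BenfattoGiulianiMastropietro2006`].  Routine consequences for the tree's countertermed action.
-/

noncomputable section

open scoped ComplexConjugate

namespace Literature.MathematicalPhysics.QuantumLattice

open Literature.Probability.LatticeModels GrassmannAlgebra Finset Literature.MathematicalPhysics.QuantumFieldTheory

/-! ### One-body facts: the propagator at the reflected frequency is the conjugate -/

section OneBody

variable (L M : ℕ)

/-- The CT denominator is even in the frequency: `den(rev ω, k⃗) = den(ω, k⃗)`. [cite: BenfattoGiulianiMastropietro2006, §2.1 symmetry (5)] -/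
theorem nambuDenCT_revFreq (β μ h : ℝ) (K : TrigPolyC4v) (i : MatsubaraIdx M) (p : TorusSite 2 L) :
    nambuDenCT L M β μ h K (i.rev, p) = nambuDenCT L M β μ h K (i, p) := by
  simp only [nambuDenCT, matsubaraFreq_rev, neg_sq]

/-- **`G_K(−ω, k⃗) = conj G_K(ω, k⃗)` entrywise** (all of `ω`, `e_K`, `h φ_d` are real). [cite: BenfattoGiulianiMastropietro2006, §2.1 symmetry (5)] -/
theorem nambuPropagatorCT_revFreq (β μ h : ℝ) (K : TrigPolyC4v) (i : MatsubaraIdx M) (p : TorusSite 2 L) (a b : Fin 2) :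
    nambuPropagatorCT L M β μ h K (i.rev, p) a b = conj (nambuPropagatorCT L M β μ h K (i, p) a b) := by
  rw [nambuPropagatorCT, nambuPropagatorCT, nambuDenCT_revFreq]
  fin_cases a <;> fin_cases b <;>
    simp [Matrix.cons_val', Matrix.cons_val_zero, Matrix.cons_val_one, matsubaraFreq_rev, map_div₀, Complex.conj_ofReal,
      Complex.conj_I]

end OneBody

/-! ### Time reversal on the field labels; the covariance is conjugated -/

section Fields

variable (L M : ℕ)

/-- The frequency reflection in coordinates. [cite: BenfattoGiulianiMastropietro2006, §2.1 symmetry (5)] -/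
theorem timeRevField_apply (X : HubbardFieldIdx L M) :
    (Equiv.prodCongr (Equiv.prodCongr (Equiv.prodCongr Fin.revPerm (Equiv.refl (TorusSite 2 L))) (Equiv.refl (Fin 2))) (Equiv.refl (Fin 2))) X = (((X.1.1.1.rev, X.1.1.2), X.1.2), X.2) := rfl

/-- The frequency reflection is injective on frequency–momenta. [cite: BenfattoGiulianiMastropietro2006, §2.1 symmetry (5)] -/
theorem revFreq_inj {k k' : FreqMomentum L M} : ((k.1.rev, k.2) : FreqMomentum L M) = (k'.1.rev, k'.2) ↔ k = k' := by
  constructor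
  · intro h
    have h1 := congrArg Prod.fst h
    have h2 := congrArg Prod.snd h
    simp only [Fin.rev_inj] at h1 h2
    exact Prod.ext h1 h2
  · intro h; rw [h]

/-- **The Nambu relabelling commutes with the frequency reflection** (`rev` is an involution, so `(−k)` reflected is `−(k` reflected`)`).
[cite: BenfattoGiulianiMastropietro2006, §2.1 symmetry (5)] -/
theorem toNambu_timeRev (X : HubbardFieldIdx L M) : toNambu ((Equiv.prodCongr (Equiv.prodCongr (Equiv.prodCongr Fin.revPerm (Equiv.refl (TorusSite 2 L))) (Equiv.refl (Fin 2))) (Equiv.refl (Fin 2))) X) = (Equiv.prodCongr (Equiv.prodCongr (Equiv.prodCongr Fin.revPerm (Equiv.refl (TorusSite 2 L))) (Equiv.refl (Fin 2))) (Equiv.refl (Fin 2))) (toNambu X) := by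
  obtain ⟨⟨⟨ω, p⟩, s⟩, c⟩ := X
  by_cases hs : s = 0
  · simp [toNambu, hs, timeRevField_apply]
  · simp [toNambu, hs, timeRevField_apply, FreqMomentum.neg, Fin.rev_rev]

/-- The relabelling on `ψ̂⁺`: `ψ̂⁺_{(ω,k⃗),σ} ↦ ψ̂⁺_{(rev ω,k⃗),σ}`. [cite: BenfattoGiulianiMastropietro2006, §2.1 symmetry (5)] -/
theorem map_timeRev_psiPlus (ω : MatsubaraIdx M) (p : TorusSite 2 L) (s : Fin 2) :
    (ExteriorAlgebra.map (LinearMap.funLeft ℂ ℂ (Equiv.symm (Equiv.prodCongr (Equiv.prodCongr (Equiv.prodCongr Fin.revPerm (Equiv.refl (TorusSite 2 L))) (Equiv.refl (Fin 2))) (Equiv.refl (Fin 2)))))) (psiPlus (ω, p) s) = psiPlus (ω.rev, p) s := by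
  unfold psiPlus
  rw [map_funLeft_gen]
  rfl

/-- The relabelling on `ψ̂⁻`: `ψ̂⁻_{(ω,k⃗),σ} ↦ ψ̂⁻_{(rev ω,k⃗),σ}`. [cite: BenfattoGiulianiMastropietro2006, §2.1 symmetry (5)] -/
theorem map_timeRev_psiMinus (ω : MatsubaraIdx M) (p : TorusSite 2 L) (s : Fin 2) :
    (ExteriorAlgebra.map (LinearMap.funLeft ℂ ℂ (Equiv.symm (Equiv.prodCongr (Equiv.prodCongr (Equiv.prodCongr Fin.revPerm (Equiv.refl (TorusSite 2 L))) (Equiv.refl (Fin 2))) (Equiv.refl (Fin 2)))))) (psiMinus (ω, p) s) = psiMinus (ω.rev, p) s := by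
  unfold psiMinus
  rw [map_funLeft_gen]
  rfl

/-- Conjugation fixes `ψ̂⁺`. [cite: BenfattoGiulianiMastropietro2006, §2.1 symmetry (5)] -/
@[simp] theorem grassmannConj_psiPlus (k : FreqMomentum L M) (s : Fin 2) : grassmannConj (psiPlus k s) = psiPlus k s :=
  grassmannConj_gen _

/-- Conjugation fixes `ψ̂⁻`. [cite: BenfattoGiulianiMastropietro2006, §2.1 symmetry (5)] -/
@[simp] theorem grassmannConj_psiMinus (k : FreqMomentum L M) (s : Fin 2) : grassmannConj (psiMinus k s) = psiMinus k s :=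
  grassmannConj_gen _

variable [NeZero L]

omit [NeZero L] in
/-- The CT Nambu two-point table at reflected frequencies is the conjugate table. [cite: BenfattoGiulianiMastropietro2006, §2.1 symmetry (5)] -/
theorem nambuTwoPointCT_timeRev (β μ h : ℝ) (K : TrigPolyC4v) (A B : (FreqMomentum L M × Fin 2) × Fin 2) :
    nambuTwoPointCT L M β μ h K ((Equiv.prodCongr (Equiv.prodCongr (Equiv.prodCongr Fin.revPerm (Equiv.refl (TorusSite 2 L))) (Equiv.refl (Fin 2))) (Equiv.refl (Fin 2))) A) ((Equiv.prodCongr (Equiv.prodCongr (Equiv.prodCongr Fin.revPerm (Equiv.refl (TorusSite 2 L))) (Equiv.refl (Fin 2))) (Equiv.refl (Fin 2))) B) = conj (nambuTwoPointCT L M β μ h K A B) := by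
  obtain ⟨⟨⟨ω, p⟩, a⟩, c⟩ := A
  obtain ⟨⟨⟨ω', p'⟩, b⟩, c'⟩ := B
  simp only [nambuTwoPointCT, timeRevField_apply]
  by_cases hk : ((ω, p) : FreqMomentum L M) = (ω', p')
  · obtain ⟨rfl, rfl⟩ := Prod.mk.inj hk
    by_cases hc : c = 1 ∧ c' = 0
    · rw [if_pos ⟨hc.1, hc.2, rfl⟩, if_pos ⟨hc.1, hc.2, rfl⟩, map_mul, Complex.conj_ofReal, nambuPropagatorCT_revFreq]
    · rw [if_neg (fun h => hc ⟨h.1, h.2.1⟩), if_neg (fun h => hc ⟨h.1, h.2.1⟩), map_zero]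
  · have hk' : ¬ ((ω.rev, p) : FreqMomentum L M) = (ω'.rev, p') := fun h => hk ((revFreq_inj L M).1 h)
    rw [if_neg (fun h => hk' h.2.2), if_neg (fun h => hk h.2.2), map_zero]

omit [NeZero L] in
/-- **The CT two-point table is conjugated by time reversal**: `⟨ψ_{(Equiv.prodCongr (Equiv.prodCongr (Equiv.prodCongr Fin.revPerm (Equiv.refl (TorusSite 2 L))) (Equiv.refl (Fin 2))) (Equiv.refl (Fin 2)))X} ψ_{(Equiv.prodCongr (Equiv.prodCongr (Equiv.prodCongr Fin.revPerm (Equiv.refl (TorusSite 2 L))) (Equiv.refl (Fin 2))) (Equiv.refl (Fin 2)))Y}⟩₀^K = conj ⟨ψ_X ψ_Y⟩₀^K`.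
[cite: BenfattoGiulianiMastropietro2006, §2.1 symmetry (5)] -/
theorem hubbardTwoPointCT_timeRev (β μ h : ℝ) (K : TrigPolyC4v) (X Y : HubbardFieldIdx L M) :
    hubbardTwoPointCT L M β μ h K ((Equiv.prodCongr (Equiv.prodCongr (Equiv.prodCongr Fin.revPerm (Equiv.refl (TorusSite 2 L))) (Equiv.refl (Fin 2))) (Equiv.refl (Fin 2))) X) ((Equiv.prodCongr (Equiv.prodCongr (Equiv.prodCongr Fin.revPerm (Equiv.refl (TorusSite 2 L))) (Equiv.refl (Fin 2))) (Equiv.refl (Fin 2))) Y) = conj (hubbardTwoPointCT L M β μ h K X Y) := by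
  rw [hubbardTwoPointCT, hubbardTwoPointCT, toNambu_timeRev, toNambu_timeRev, nambuTwoPointCT_timeRev, nambuTwoPointCT_timeRev,
    map_sub]

omit [NeZero L] in
/-- **The CT covariance is conjugated by time reversal**: `C^K((Equiv.prodCongr (Equiv.prodCongr (Equiv.prodCongr Fin.revPerm (Equiv.refl (TorusSite 2 L))) (Equiv.refl (Fin 2))) (Equiv.refl (Fin 2)))X, (Equiv.prodCongr (Equiv.prodCongr (Equiv.prodCongr Fin.revPerm (Equiv.refl (TorusSite 2 L))) (Equiv.refl (Fin 2))) (Equiv.refl (Fin 2)))Y) = conj C^K(X, Y)`. [cite: BenfattoGiulianiMastropietro2006, §2.1 symmetry (5)] -/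
theorem hubbardCovarianceCT_timeRev (β μ h : ℝ) (K : TrigPolyC4v) (X Y : HubbardFieldIdx L M) :
    hubbardCovarianceCT L M β μ h K ((Equiv.prodCongr (Equiv.prodCongr (Equiv.prodCongr Fin.revPerm (Equiv.refl (TorusSite 2 L))) (Equiv.refl (Fin 2))) (Equiv.refl (Fin 2))) X) ((Equiv.prodCongr (Equiv.prodCongr (Equiv.prodCongr Fin.revPerm (Equiv.refl (TorusSite 2 L))) (Equiv.refl (Fin 2))) (Equiv.refl (Fin 2))) Y) = conj (hubbardCovarianceCT L M β μ h K X Y) := by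
  simp only [hubbardCovarianceCT, Matrix.of_apply, hubbardTwoPointCT_timeRev, map_neg]

omit [NeZero L] in
/-- The CT cutoff weight is even in the frequency. [cite: BenfattoGiulianiMastropietro2006, §2.1 symmetry (5)] -/
theorem hubbardCutoffWeightCT_revFreq (β μ : ℝ) (K : TrigPolyC4v) (Λ : ℝ) (k : FreqMomentum L M) :
    hubbardCutoffWeightCT L M β μ K Λ (k.1.rev, k.2) = hubbardCutoffWeightCT L M β μ K Λ k := by
  simp only [hubbardCutoffWeightCT, matsubaraFreq_rev, neg_sq]

omit [NeZero L] in
/-- **The CT covariance above scale `Λ` is conjugated by time reversal**: `C^K_{>Λ}((Equiv.prodCongr (Equiv.prodCongr (Equiv.prodCongr Fin.revPerm (Equiv.refl (TorusSite 2 L))) (Equiv.refl (Fin 2))) (Equiv.refl (Fin 2)))X, (Equiv.prodCongr (Equiv.prodCongr (Equiv.prodCongr Fin.revPerm (Equiv.refl (TorusSite 2 L))) (Equiv.refl (Fin 2))) (Equiv.refl (Fin 2)))Y) = conj C^K_{>Λ}(X, Y)` — the antilinear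
symmetry of the Gaussian integration (BGM 2006 §2.1 (5) with the frequency reflection). [cite: BenfattoGiulianiMastropietro2006, §2.1 symmetry (5)] -/
theorem hubbardCovAboveCT_timeRev (β μ h : ℝ) (K : TrigPolyC4v) (Λ : ℝ) (X Y : HubbardFieldIdx L M) :
    hubbardCovAboveCT L M β μ h K Λ ((Equiv.prodCongr (Equiv.prodCongr (Equiv.prodCongr Fin.revPerm (Equiv.refl (TorusSite 2 L))) (Equiv.refl (Fin 2))) (Equiv.refl (Fin 2))) X) ((Equiv.prodCongr (Equiv.prodCongr (Equiv.prodCongr Fin.revPerm (Equiv.refl (TorusSite 2 L))) (Equiv.refl (Fin 2))) (Equiv.refl (Fin 2))) Y) = conj (hubbardCovAboveCT L M β μ h K Λ X Y) := by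
  have hX : hubbardCutoffWeightCT L M β μ K Λ (momentumOf L M ((Equiv.prodCongr (Equiv.prodCongr (Equiv.prodCongr Fin.revPerm (Equiv.refl (TorusSite 2 L))) (Equiv.refl (Fin 2))) (Equiv.refl (Fin 2))) X)) = hubbardCutoffWeightCT L M β μ K Λ (momentumOf L M X) :=
    hubbardCutoffWeightCT_revFreq L M β μ K Λ X.1.1
  have hY : hubbardCutoffWeightCT L M β μ K Λ (momentumOf L M ((Equiv.prodCongr (Equiv.prodCongr (Equiv.prodCongr Fin.revPerm (Equiv.refl (TorusSite 2 L))) (Equiv.refl (Fin 2))) (Equiv.refl (Fin 2))) Y)) = hubbardCutoffWeightCT L M β μ K Λ (momentumOf L M Y) :=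
    hubbardCutoffWeightCT_revFreq L M β μ K Λ Y.1.1
  simp only [hubbardCovAboveCT, Matrix.of_apply, hubbardCovarianceCT_timeRev, map_mul, Complex.conj_ofReal, hX, hY]

/-! ### Invariance of the interaction slot -/

/-- The Hubbard vertex has real coefficients: `conj V = V`. [cite: BenfattoGiulianiMastropietro2006, §2.1 symmetry (5)] -/
theorem grassmannConj_hubbardInteraction (β U : ℝ) : grassmannConj (hubbardInteraction L M β U) = hubbardInteraction L M β U := by
  rw [hubbardInteraction, grassmannConj_smul, Complex.conj_ofReal, map_sum]
  congr 1
  refine Finset.sum_congr rfl fun k₁ _ => ?_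
  rw [map_sum]
  refine Finset.sum_congr rfl fun k₂ _ => ?_
  rw [map_sum]
  refine Finset.sum_congr rfl fun k₃ _ => ?_
  rw [map_sum]
  refine Finset.sum_congr rfl fun k₄ _ => ?_
  split_ifs
  · simp only [map_mul, grassmannConj_psiPlus, grassmannConj_psiMinus]
  · exact map_zero _

/-- The counterterm vertex has real coefficients: `conj 𝒩_K = 𝒩_K`. [cite: BenfattoGiulianiMastropietro2006, §2.1 symmetry (5)] -/
theorem grassmannConj_counterQuadratic (β : ℝ) (K : TrigPolyC4v) :
    grassmannConj (counterQuadratic L M β K) = counterQuadratic L M β K := by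
  rw [counterQuadratic, map_sum]
  refine Finset.sum_congr rfl fun k _ => ?_
  rw [map_sum]
  refine Finset.sum_congr rfl fun s _ => ?_
  rw [grassmannConj_smul, Complex.conj_ofReal, map_mul, grassmannConj_psiPlus, grassmannConj_psiMinus]

/-- The conservation law of the integer frequency labels is invariant under `n ↦ −n − 1` on all four legs.
[cite: BenfattoGiulianiMastropietro2006, §2.1 symmetry (5)] -/
theorem matsubaraInt_rev_conservation_iff (a b c d : MatsubaraIdx M) :
    matsubaraInt M a.rev + matsubaraInt M c.rev = matsubaraInt M b.rev + matsubaraInt M d.rev ↔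
      matsubaraInt M a + matsubaraInt M c = matsubaraInt M b + matsubaraInt M d := by
  simp only [matsubaraInt_rev]
  constructor <;> intro h <;> linarith

/-- **The Hubbard vertex is invariant under the frequency reflection**: `V ∘ (Equiv.prodCongr (Equiv.prodCongr (Equiv.prodCongr Fin.revPerm (Equiv.refl (TorusSite 2 L))) (Equiv.refl (Fin 2))) (Equiv.refl (Fin 2)))⁻¹ = V`. [cite: BenfattoGiulianiMastropietro2006, §2.1 symmetry (5)] -/
theorem map_timeRev_hubbardInteraction (β U : ℝ) : (ExteriorAlgebra.map (LinearMap.funLeft ℂ ℂ (Equiv.symm (Equiv.prodCongr (Equiv.prodCongr (Equiv.prodCongr Fin.revPerm (Equiv.refl (TorusSite 2 L))) (Equiv.refl (Fin 2))) (Equiv.refl (Fin 2)))))) (hubbardInteraction L M β U) = hubbardInteraction L M β U := by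
  rw [hubbardInteraction, map_smul]
  congr 1
  rw [map_sum]
  refine Fintype.sum_equiv (Equiv.prodCongr Fin.revPerm (Equiv.refl (TorusSite 2 L))) _ _ fun k₁ => ?_
  obtain ⟨ω₁, p₁⟩ := k₁
  rw [map_sum]
  refine Fintype.sum_equiv (Equiv.prodCongr Fin.revPerm (Equiv.refl (TorusSite 2 L))) _ _ fun k₂ => ?_
  obtain ⟨ω₂, p₂⟩ := k₂
  rw [map_sum]
  refine Fintype.sum_equiv (Equiv.prodCongr Fin.revPerm (Equiv.refl (TorusSite 2 L))) _ _ fun k₃ => ?_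
  obtain ⟨ω₃, p₃⟩ := k₃
  rw [map_sum]
  refine Fintype.sum_equiv (Equiv.prodCongr Fin.revPerm (Equiv.refl (TorusSite 2 L))) _ _ fun k₄ => ?_
  obtain ⟨ω₄, p₄⟩ := k₄
  simp only [Equiv.prodCongr_apply, Prod.map_apply, Equiv.refl_apply, Fin.revPerm_apply, matsubaraInt_rev_conservation_iff]
  split_ifs
  · simp only [map_mul, map_timeRev_psiPlus, map_timeRev_psiMinus]
  · exact map_zero _

/-- **The counterterm vertex is invariant under the frequency reflection**: `𝒩_K ∘ (Equiv.prodCongr (Equiv.prodCongr (Equiv.prodCongr Fin.revPerm (Equiv.refl (TorusSite 2 L))) (Equiv.refl (Fin 2))) (Equiv.refl (Fin 2)))⁻¹ = 𝒩_K`. [cite: BenfattoGiulianiMastropietro2006, §2.1 symmetry (5)] -/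
theorem map_timeRev_counterQuadratic (β : ℝ) (K : TrigPolyC4v) : (ExteriorAlgebra.map (LinearMap.funLeft ℂ ℂ (Equiv.symm (Equiv.prodCongr (Equiv.prodCongr (Equiv.prodCongr Fin.revPerm (Equiv.refl (TorusSite 2 L))) (Equiv.refl (Fin 2))) (Equiv.refl (Fin 2)))))) (counterQuadratic L M β K) = counterQuadratic L M β K := by
  rw [counterQuadratic, map_sum]
  refine Fintype.sum_equiv (Equiv.prodCongr Fin.revPerm (Equiv.refl (TorusSite 2 L))) _ _ fun k => ?_
  obtain ⟨ω, p⟩ := k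
  simp only [map_sum, map_smul, map_mul, map_timeRev_psiPlus, map_timeRev_psiMinus, Equiv.prodCongr_apply, Prod.map_apply,
    Equiv.refl_apply, Fin.revPerm_apply]

/-- **The interaction slot is invariant under time reversal**: `(conj V_K) ∘ (Equiv.prodCongr (Equiv.prodCongr (Equiv.prodCongr Fin.revPerm (Equiv.refl (TorusSite 2 L))) (Equiv.refl (Fin 2))) (Equiv.refl (Fin 2)))⁻¹ = V_K`. [cite: BenfattoGiulianiMastropietro2006, §2.1 symmetry (5)] -/
theorem map_timeRev_grassmannConj_hubbardInteractionCT (β U : ℝ) (K : TrigPolyC4v) :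
    (ExteriorAlgebra.map (LinearMap.funLeft ℂ ℂ (Equiv.symm (Equiv.prodCongr (Equiv.prodCongr (Equiv.prodCongr Fin.revPerm (Equiv.refl (TorusSite 2 L))) (Equiv.refl (Fin 2))) (Equiv.refl (Fin 2)))))) (grassmannConj (hubbardInteractionCT L M β U K)) = hubbardInteractionCT L M β U K := by
  rw [hubbardInteractionCT, map_add, grassmannConj_hubbardInteraction, grassmannConj_counterQuadratic, map_add,
    map_timeRev_hubbardInteraction, map_timeRev_counterQuadratic]

/-- **Time reversal is a symmetry of the countertermed effective action**: `(conj 𝒢^K_Λ) ∘ (Equiv.prodCongr (Equiv.prodCongr (Equiv.prodCongr Fin.revPerm (Equiv.refl (TorusSite 2 L))) (Equiv.refl (Fin 2))) (Equiv.refl (Fin 2)))⁻¹ = 𝒢^K_Λ` for every seed `h`, frame `K`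
and scale `Λ` (BGM 2006 §2.1: the antilinear symmetry passes to the effective potentials). [cite: BenfattoGiulianiMastropietro2006, §2.1 symmetry (5)] -/
theorem map_timeRev_grassmannConj_hubbardEffectiveActionCT (β U μ h : ℝ) (K : TrigPolyC4v) (Λ : ℝ) :
    (ExteriorAlgebra.map (LinearMap.funLeft ℂ ℂ (Equiv.symm (Equiv.prodCongr (Equiv.prodCongr (Equiv.prodCongr Fin.revPerm (Equiv.refl (TorusSite 2 L))) (Equiv.refl (Fin 2))) (Equiv.refl (Fin 2)))))) (grassmannConj (hubbardEffectiveActionCT L M β U μ h K Λ)) = hubbardEffectiveActionCT L M β U μ h K Λ :=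
  map_funLeft_grassmannConj_effAction_of_invariant _ (hubbardCovAboveCT_timeRev L M β μ h K Λ)
    (map_timeRev_grassmannConj_hubbardInteractionCT L M β U K)

/-- **The kernels of the countertermed effective action at reflected frequencies are the conjugates**:
`F_m((Equiv.prodCongr (Equiv.prodCongr (Equiv.prodCongr Fin.revPerm (Equiv.refl (TorusSite 2 L))) (Equiv.refl (Fin 2))) (Equiv.refl (Fin 2)))X_0, …, (Equiv.prodCongr (Equiv.prodCongr (Equiv.prodCongr Fin.revPerm (Equiv.refl (TorusSite 2 L))) (Equiv.refl (Fin 2))) (Equiv.refl (Fin 2)))X_{m−1}) = conj F_m(X_0, …, X_{m−1})` (BGM 2006 §2.3: `W(−k₀) = W(k₀)*`). [cite: BenfattoGiulianiMastropietro2006, §2.1 symmetry (5)] -/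
theorem kernel_hubbardEffectiveActionCT_timeRev (β U μ h : ℝ) (K : TrigPolyC4v) (Λ : ℝ) (m : ℕ) (X : Fin m → HubbardFieldIdx L M) :
    kernel ℂ (hubbardEffectiveActionCT L M β U μ h K Λ) m ((Equiv.prodCongr (Equiv.prodCongr (Equiv.prodCongr Fin.revPerm (Equiv.refl (TorusSite 2 L))) (Equiv.refl (Fin 2))) (Equiv.refl (Fin 2))) ∘ X) = conj (kernel ℂ (hubbardEffectiveActionCT L M β U μ h K Λ) m X) :=
  kernel_comp_perm_eq_conj_of_invariant _ (map_timeRev_grassmannConj_hubbardEffectiveActionCT L M β U μ h K Λ) m X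

end Fields

/-! ### The self-energy at the reflected frequency -/

section Functionals

variable (L M : ℕ) {G : HubbardGrassmann L M}
  (hG : ∀ (m : ℕ) (X : Fin m → HubbardFieldIdx L M), kernel ℂ G m ((Equiv.prodCongr (Equiv.prodCongr (Equiv.prodCongr Fin.revPerm (Equiv.refl (TorusSite 2 L))) (Equiv.refl (Fin 2))) (Equiv.refl (Fin 2))) ∘ X) = conj (kernel ℂ G m X))

include hG

/-- **The self-energy of a time-reversal-invariant `G`**: `Σ((rev ω, k⃗), σ) = conj Σ((ω, k⃗), σ)`. [cite: BenfattoGiulianiMastropietro2006, §2.3] -/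
theorem selfEnergy_timeRev (β : ℝ) (ω : MatsubaraIdx M) (p : TorusSite 2 L) (s : Fin 2) :
    selfEnergy L M β G (ω.rev, p) s = conj (selfEnergy L M β G (ω, p) s) := by
  rw [selfEnergy, selfEnergy, vertexFn, vertexFn, map_mul, Complex.conj_ofReal, ← hG 2 ![(((ω, p), s), 0), (((ω, p), s), 1)]]
  congr 2
  funext i
  fin_cases i <;> rfl

end Functionals

section CT

variable (L M : ℕ) [NeZero L]

/-- **`Σ(−ω, k⃗) = conj Σ(ω, k⃗)` for the countertermed effective action** `𝒢^K_Λ` (every seed, frame and scale) — BGM 2006 §2.3.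
[cite: BenfattoGiulianiMastropietro2006, §2.3] -/
theorem selfEnergy_hubbardEffectiveActionCT_revFreq (β U μ h : ℝ) (K : TrigPolyC4v) (Λ : ℝ) (ω : MatsubaraIdx M) (p : TorusSite 2 L)
    (s : Fin 2) :
    selfEnergy L M β (hubbardEffectiveActionCT L M β U μ h K Λ) (ω.rev, p) s =
      conj (selfEnergy L M β (hubbardEffectiveActionCT L M β U μ h K Λ) (ω, p) s) :=
  selfEnergy_timeRev L M (kernel_hubbardEffectiveActionCT_timeRev L M β U μ h K Λ) β ω p s

end CT

end Literature.MathematicalPhysics.QuantumLattice
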